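import Literature.Geometry.Riemannian.RicciDeTurckFlow
import Literature.Geometry.Lorentzian.ChartScalarCurvature
import Literature.Geometry.Lorentzian.ScalarCurvatureLinearization
import Literature.Geometry.Lorentzian.LeviCivitaCurvature
import HarnessLib

/-!
# The Ricci–DeTurck operator in coordinates: strict parabolicity
(topic `Geometry/Riemannian`)

Third layer of the DeTurck decomposition of the named fact
`Literature.Geometry.Riemannian.ricciFlow_uniqueness` (`RicciFlow.lean`; Hamilton 1982,
Thm. 5.1; Topping 2006, Thm. 5.2.2), after `RicciDeTurckFlow.lean` (the DeTurck field `W`, the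
Ricci–DeTurck flow `∂ₜg = -2 Ric + ℒ_W g`) and `RicciDeTurckReduction.lean` (Andrews–Hopper 2011,
§5.4.2, Step 6, PROVED: uniqueness of the Ricci flow on a closed manifold follows from
(RU) uniqueness for the Ricci–DeTurck flow and (GE) existence of the DeTurck gauge). The input
(RU) is, in print, "from (5.9), the Ricci–DeTurck flow is strictly parabolic"
(Andrews–Hopper 2011, §5.4.2, Step 1; Topping 2006, §5.2, Step 1; DeTurck 1983): the principal
symbol of the linearisation of `Q = -2 Ric + ℒ_W g` is `σ(ξ) h = |ξ|²_g h`. This file PROVES the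
exact, nonlinear coordinate statement behind it, in the single-chart calculus of the tree
(`Lorentzian/ChartCalculus.lean`, `ChartConnection.lean`, `ChartScalarCurvature.lean`: metrics
on `U : Opens E` with components `G : E → (E →L E →L ℝ)`):

  `-2 Ric_g(X₀, Y₀) + ℒ_W g (X₀, Y₀) = ∑ᵢⱼ gʲⁱ D²G(x)(bᵢ, bⱼ)(X₀, Y₀) + F(x)(X₀, Y₀)`

(`rdt_rhs_eq_coord`, `rdt_rhs_eq_coord_of_isLeviCivita`), where `b` is any basis of `E`,
`(gʲⁱ)` the inverse Gram matrix, the principal part `∑ gʲⁱ D²G(bᵢ,bⱼ) = tr_g D²G(·,·) =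
gᵖ𐞥∂_p∂_q G` is basis-free (`principal_eq_trace`), and the remainder `F = rdtLower …` is an
EXPLICIT polynomial expression in the first-order data only — the components `G(x)`, the inverse
Gram matrix, the first derivative `DG(x)`, the background Christoffel vectors `Γ̃(bᵢ,bⱼ)(x)` and
their first derivatives. No second derivative of the metric enters `F`: the system
`∂ₜ G = gᵖ𐞥 ∂_p∂_q G + F(G, ∂G)` is quasilinear strictly parabolic. Everything is proved; no
named fact and no `sorry` is introduced.

## Contents (all proved)

* Data level (`section Data`): `kos` (the Koszul combination of a first derivative,
  `= koszulForm`), `gramInv`, `dGramInv` (`∂(g⁻¹) = -g⁻¹ (∂g) g⁻¹`), `wflat` (`W♭(Z) = g(W, Z)`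
  through the data), `wflatFun`, `chris` (the Christoffel vector through the data), `ricLower`,
  `lieLowerHalf`, `rdtLower` (the first-order remainder), `sndDerivFormE`, `gramInv_symm`, and
  **`principal_cancel`** — the algebraic identity of DeTurck's trick: for `S(V,A,B,C)` symmetric
  in `(V,A)` and in `(B,C)` and `gʲⁱ` symmetric, the twelve second-order terms of
  `-2 Ric + ℒ_W g` collapse to `gʲⁱ S(bᵢ, bⱼ, X, Y)`.
* Calculus (`section Calculus`): `fderiv_matrix_inv_apply` (derivative of the inverse of a
  matrix of `C¹` functions), `fderiv_apply_moving`, `differentiableAt_gramInv_apply`,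
  `differentiableAt_wflatFun`, **`fderiv_wflatFun`** and `fderiv_wflatFun_split` (the derivative
  of `W♭(Z)` along `E`, split into `½ gʲⁱ ∂K` and first-order terms), `fderiv_fderiv_symm₁₂`
  (Schwarz), `fderiv_fderiv_symm₃₄` (symmetry of `G` passes to `D²G`).
* On `U : Opens E` (`section Ident`): `basisT` (a basis of `E` as a basis of `T_x U`), `gram_eq`,
  `christoffel_eq_chris`, `principal_eq_trace`, `difference_const_apply` and
  `val_difference_const` (Mathlib's difference tensor of `∇` and the background `∇̃` on constant
  fields: `Γ - Γ̃`), **`val_deTurckField_eq_wflat`** and `deTurckField_eq_sum` (the DeTurck field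
  `W = gᵖ𐞥(Γ_{pq} - Γ̃_{pq})` in coordinates, Andrews–Hopper (5.7)),
  `mdifferentiableAt_deTurckField`, `val_leviCivita_deTurckField` (metric compatibility:
  `g(∇_X W, Y) = ∂_X W♭(Y) - W♭(Γ(X,Y))`), **`lieDerivMetric_deTurckField_eq`** (`ℒ_W g` in
  coordinates), **`neg_two_mul_ricci_eq`** (`-2 Ric` in coordinates split into `∂Γ` and `ΓΓ`
  parts; O'Neill 1983, Lemma 3.38 / 3.52 via `val_riemann_eq`, `ricci_eq_sum`), and the structure
  theorems `rdt_rhs_eq_coord`, `rdt_rhs_eq_coord_of_isLeviCivita`.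

## Design notes

* The background connection `bg` is an arbitrary covariant derivative on `TU`; it enters only
  through its action on constant fields, represented by `Cb : E → E → E → E`
  (`∇̃_{X₀} Y₀ (y) = Cb y Y₀ X₀`) with components differentiable at the point. For the
  Levi-Civita connection of a smooth background metric `h` with components `Hh` one takes
  `Cb y Y₀ X₀ = christoffel h Hh y Y₀ X₀` (`leviCivita_const_apply`).
* `F` takes the inverse Gram matrix as a separate argument (instantiated with `gramInv b (G x)`),
  so that it is visibly polynomial in its arguments; this is the form needed for the comparison
  of two solutions (`F(G₁, …) - F(G₂, …)` is controlled by `G₁ - G₂` and `DG₁ - DG₂`).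
* As in `ChartCalculus.lean`, identities are stated at the model type `E`; the fibrewise lemmas
  of the tree (`sharp_eq_sum`, `trace_eq_sum_gram_inv`, `ricci_eq_sum`) are instantiated with the
  copy `basisT b x` of the basis at the tangent space (definitionally `b`).

## References

* B. Andrews, C. Hopper, *The Ricci flow in Riemannian geometry*, LNM 2011, Springer 2011,
  §5.4.1, (5.6)–(5.9) (`DQ(h) = Δh + A`, `σ[DQ](ζ)h = |ζ|²h`), §5.4.2, Step 1 and (5.10).
  [AndrewsHopper2011]
* D. M. DeTurck, *Deforming metrics in the direction of their Ricci tensors*, J. Differential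
  Geom. 18 (1983) 157–162. [DeTurck1983]
* P. Topping, *Lectures on the Ricci flow*, LMS LNS 325 (2006), §5.2, Step 1 (p. 44–45).
  [Topping2006]
* B. O'Neill, *Semi-Riemannian geometry*, Academic Press 1983, Ch. 3, Thm. 3.11, Prop. 3.13,
  Lemma 3.38, Lemma 3.52, pp. 60–61. [ONeill1983]
-/

noncomputable section

set_option maxSynthPendingDepth 3

open Bundle Set Function Filter ContinuousLinearMap TopologicalSpace
open scoped Manifold ContDiff Topology

namespace Literature.Geometry.Riemannian

open Lorentzian Lorentzian.OpensChart Lorentzian.PseudoRiemannianMetric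

namespace OpensChart

/-! ### Layer 0: the first-order data and the explicit lower-order expressions -/

section Data

variable {E : Type*} [NormedAddCommGroup E] [NormedSpace ℝ E]
  {ι : Type*} [Fintype ι] [DecidableEq ι] (b : Module.Basis ι ℝ E)

/-- The Koszul combination `K(Z, Y, W) = D(Y)(Z, W) + D(Z)(W, Y) - D(W)(Y, Z)` of a first
derivative `D = DG(x)` of metric components (`= koszulForm G x Z Y W` for `D = fderiv ℝ G x`,
`kos_fderiv`; twice the Christoffel symbols of the first kind). [cite: ONeill1983, Ch. 3, Prop. 3.13] -/
def kos (D : E →L[ℝ] E →L[ℝ] E →L[ℝ] ℝ) (Z Y W : E) : ℝ := D Y Z W + D Z W Y - D W Y Z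

omit [Fintype ι] [DecidableEq ι] in
/-- `kos (DG(x)) Z Y W = koszulForm G x Z Y W`. [folklore] -/
@[simp]
theorem kos_fderiv (G : E → E →L[ℝ] E →L[ℝ] ℝ) (x : E) (Z Y W : E) :
    kos (fderiv ℝ G x) Z Y W = koszulForm G x Z Y W := by
  rw [kos, koszulForm_apply]

/-- The inverse Gram matrix `(G(bᵢ, bⱼ))⁻¹ = (gⁱʲ)` of a bilinear form in the basis `b`. [folklore] -/
def gramInv (A : E →L[ℝ] E →L[ℝ] ℝ) : Matrix ι ι ℝ := (Matrix.of fun i j ↦ A (b i) (b j))⁻¹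

/-- The directional derivative `∂_V (gⁱʲ) = -(g⁻¹ (∂_V g) g⁻¹)ⁱʲ` of the inverse Gram matrix,
as an explicit expression in the inverse Gram matrix `Gi` and the first derivative `D` of the
components (`hasFDerivAt_gramInv`). [folklore] -/
def dGramInv (Gi : Matrix ι ι ℝ) (D : E →L[ℝ] E →L[ℝ] E →L[ℝ] ℝ) (V : E) : Matrix ι ι ℝ :=
  Matrix.of fun j i ↦ -∑ a, ∑ c, Gi j a * D V (b a) (b c) * Gi c i

/-- The metric dual `W♭(Z) = g(W, Z) = gⁱʲ (½ K(bᵢ, bⱼ, Z) - g(Γ̃(bᵢ, bⱼ), Z))` of the DeTurck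
vector field `W = gⁱʲ(Γᵢⱼ - Γ̃ᵢⱼ)` as an explicit expression in the first-order data: the
components `A = G(x)`, the inverse Gram matrix `Gi`, the first derivative `D = DG(x)` and the
background Christoffel vectors `C Y₀ X₀ = Γ̃_x(X₀, Y₀)` (`val_deTurckField_eq_wflat`).
[cite: AndrewsHopper2011, §5.4.1, (5.7)] -/
def wflat (A : E →L[ℝ] E →L[ℝ] ℝ) (Gi : Matrix ι ι ℝ) (D : E →L[ℝ] E →L[ℝ] E →L[ℝ] ℝ)
    (C : E → E → E) (Z : E) : ℝ :=
  ∑ i, ∑ j, Gi j i * (2⁻¹ * kos D (b i) (b j) Z - A (C (b i) (b j)) Z)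

/-- The function `y ↦ W♭(Z)(y) = g_y(W_y, Z)` along `E` built from representatives `G` of the
metric components and `Cb` of the background Christoffel field: `wflat` of the first-order data
of `G` at `y` (`val_deTurckField_eq_wflatFun`). [cite: AndrewsHopper2011, §5.4.1, (5.7)] -/
def wflatFun (G : E → E →L[ℝ] E →L[ℝ] ℝ) (Cb : E → E → E → E) (y Z : E) : ℝ :=
  wflat b (G y) (gramInv b (G y)) (fderiv ℝ G y) (Cb y) Z

/-- The Christoffel vector `Γ_x(X₀, Y₀) = ∑ₐ (∑_c g^{ca} ½ K(Y₀, X₀, b_c)) bₐ` as an explicit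
expression in the first-order data (`christoffel_eq_chris`). [cite: ONeill1983, Ch. 3, Prop. 3.13] -/
def chris (Gi : Matrix ι ι ℝ) (D : E →L[ℝ] E →L[ℝ] E →L[ℝ] ℝ) (Y₀ X₀ : E) : E :=
  ∑ a, (∑ c, Gi c a * (2⁻¹ * kos D Y₀ X₀ (b c))) • b a

/-- The first-order part of `-2 Ric` in coordinates: the `ΓΓ` terms
`-2 gʲⁱ (-g(Γ(bⱼ,bᵢ), Γ(b_?, ?)) + …)` of O'Neill's `R = ∂Γ − ∂Γ + ΓΓ − ΓΓ` contracted with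
the inverse metric (`val_riemann_eq`, `val_christoffel_christoffel_eq_sum`). [cite: ONeill1983, Ch. 3, Lemma 3.38] -/
def ricLower (Gi : Matrix ι ι ℝ) (D : E →L[ℝ] E →L[ℝ] E →L[ℝ] ℝ) (X₀ Y₀ : E) : ℝ :=
  -2 * ∑ i, ∑ j, Gi j i *
    (-(∑ a, ∑ c, Gi c a * (2⁻¹ * kos D (b j) (b i) (b c)) * (2⁻¹ * kos D Y₀ X₀ (b a)))
      + ∑ a, ∑ c, Gi c a * (2⁻¹ * kos D (b j) X₀ (b c)) * (2⁻¹ * kos D Y₀ (b i) (b a)))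

/-- One half of the first-order part of the Lie derivative term `ℒ_W g (X₀, Y₀)`: the terms of
`∂_{X₀} (W♭(Y₀))` not involving second derivatives of the metric, i.e. those where the derivative
falls on the inverse metric or on the background term `g(Γ̃(bᵢ, bⱼ), Y₀)` (`DC V Y₀ X₀ = ∂_V Γ̃(X₀, Y₀)`). [folklore] -/
def lieLowerHalf (A : E →L[ℝ] E →L[ℝ] ℝ) (Gi : Matrix ι ι ℝ) (D : E →L[ℝ] E →L[ℝ] E →L[ℝ] ℝ)
    (C : E → E → E) (DC : E → E → E → E) (X₀ Y₀ : E) : ℝ :=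
  ∑ i, ∑ j, (dGramInv b Gi D X₀ j i * (2⁻¹ * kos D (b i) (b j) Y₀ - A (C (b i) (b j)) Y₀)
    + Gi j i * (-(D X₀ (C (b i) (b j)) Y₀) - A (DC X₀ (b i) (b j)) Y₀))

/-- **The first-order part of the Ricci–DeTurck operator in coordinates**: an explicit polynomial
expression `F(A, Gi, D, C, DC)(X₀, Y₀)` in the metric components `A = G(x)`, the inverse Gram
matrix `Gi`, the first derivative `D = DG(x)`, the background Christoffel vectors `C` and their
first derivatives `DC`, such that
`-2 Ric(X₀, Y₀) + ℒ_W g (X₀, Y₀) = gᵖ𐞥 ∂²_{b_p b_q} G (X₀, Y₀) + F` (`rdt_rhs_eq_coord`).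
[cite: AndrewsHopper2011, §5.4.1, (5.6)–(5.9)] -/
def rdtLower (A : E →L[ℝ] E →L[ℝ] ℝ) (Gi : Matrix ι ι ℝ) (D : E →L[ℝ] E →L[ℝ] E →L[ℝ] ℝ)
    (C : E → E → E) (DC : E → E → E → E) (X₀ Y₀ : E) : ℝ :=
  ricLower b Gi D X₀ Y₀
    + (lieLowerHalf b A Gi D C DC X₀ Y₀ + lieLowerHalf b A Gi D C DC Y₀ X₀
        - wflat b A Gi D C (chris b Gi D Y₀ X₀) - wflat b A Gi D C (chris b Gi D X₀ Y₀))

/-- The bilinear form `(v, w) ↦ D(v, w)(X₀, Y₀)` on `E` cut out of a second derivative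
`D = D²G(x)` of metric components. [folklore] -/
def sndDerivFormE (D : E →L[ℝ] E →L[ℝ] E →L[ℝ] E →L[ℝ] ℝ) (X₀ Y₀ : E) :
    LinearMap.BilinForm ℝ E :=
  LinearMap.mk₂ ℝ (fun v w ↦ D v w X₀ Y₀)
    (fun v v' w ↦ by simp only [map_add, _root_.add_apply])
    (fun c v w ↦ by simp only [map_smul, _root_.smul_apply, smul_eq_mul])
    (fun v w w' ↦ by simp only [map_add, _root_.add_apply])
    (fun c v w ↦ by simp only [map_smul, _root_.smul_apply, smul_eq_mul])

omit [Fintype ι] [DecidableEq ι] in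
/-- Unfolding lemma for `sndDerivFormE`. [folklore] -/
@[simp]
theorem sndDerivFormE_apply (D : E →L[ℝ] E →L[ℝ] E →L[ℝ] E →L[ℝ] ℝ) (X₀ Y₀ v w : E) :
    sndDerivFormE D X₀ Y₀ v w = D v w X₀ Y₀ := rfl

/-- The inverse Gram matrix of a symmetric form is symmetric. [folklore] -/
theorem gramInv_symm {A : E →L[ℝ] E →L[ℝ] ℝ} (hA : ∀ v w, A v w = A w v) (i j : ι) :
    gramInv b A i j = gramInv b A j i := by
  have hT : (Matrix.of fun i j ↦ A (b i) (b j)).transpose = Matrix.of fun i j ↦ A (b i) (b j) := by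
    ext i j
    exact hA _ _
  have h : (gramInv b A).transpose = gramInv b A := by
    rw [gramInv, Matrix.transpose_nonsing_inv, hT]
  conv_lhs => rw [← h]
  rfl

omit [DecidableEq ι] in
/-- **The principal-symbol cancellation of DeTurck's trick** (Andrews–Hopper 2011, §5.4.1,
(5.6)–(5.9): `-2 DRic(h) = Δh - ∇V - ∇V + …`, `DP(h) = ∇V + ∇V + …`, so `D(-2Ric + P) h = Δh
+ (first order)`), as the exact algebraic identity behind it: for any `S(V, A, B, C)` symmetric
in `(V, A)` (symmetry of second derivatives) and in `(B, C)` (symmetry of the metric) and any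
symmetric matrix `gʲⁱ`, the second-order terms of `-2 Ric` (from `∂Γ - ∂Γ`) and of `ℒ_W g`
(from `∂ᵢWⱼ + ∂ⱼWᵢ`) add up to `gʲⁱ S(bᵢ, bⱼ, X, Y)` alone, i.e. to `gⁱʲ ∂ᵢ∂ⱼ g(X, Y)`.
[cite: AndrewsHopper2011, §5.4.1, (5.6)–(5.9)] -/
theorem principal_cancel (S : E → E → E → E → ℝ) (h12 : ∀ a c d e, S a c d e = S c a d e)
    (h34 : ∀ a c d e, S a c d e = S a c e d) (Gi : Matrix ι ι ℝ) (hGi : ∀ i j, Gi i j = Gi j i)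
    (X Y : E) :
    -(∑ i, ∑ j, Gi j i * ((S (b i) X Y (b j) + S (b i) Y (b j) X - S (b i) (b j) X Y)
        - (S X (b i) Y (b j) + S X Y (b j) (b i) - S X (b j) (b i) Y)))
      + 2⁻¹ * (∑ i, ∑ j, Gi j i * (S X (b j) (b i) Y + S X (b i) Y (b j) - S X Y (b j) (b i)))
      + 2⁻¹ * (∑ i, ∑ j, Gi j i * (S Y (b j) (b i) X + S Y (b i) X (b j) - S Y X (b j) (b i)))
      = ∑ i, ∑ j, Gi j i * S (b i) (b j) X Y := by
  have hswap : ∀ f : ι → ι → ℝ, ∑ i, ∑ j, Gi j i * f i j = ∑ i, ∑ j, Gi j i * f j i := by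
    intro f
    rw [Finset.sum_comm]
    exact Finset.sum_congr rfl fun i _ ↦ Finset.sum_congr rfl fun j _ ↦ by rw [hGi]
  have ha4 : ∑ i, ∑ j, Gi j i * S X (b i) Y (b j) = ∑ i, ∑ j, Gi j i * S (b i) X Y (b j) :=
    Finset.sum_congr rfl fun i _ ↦ Finset.sum_congr rfl fun j _ ↦ by rw [h12]
  have ha6 : ∑ i, ∑ j, Gi j i * S X (b j) (b i) Y = ∑ i, ∑ j, Gi j i * S (b i) X Y (b j) := by
    rw [hswap (fun i j ↦ S X (b j) (b i) Y)]
    exact Finset.sum_congr rfl fun i _ ↦ Finset.sum_congr rfl fun j _ ↦ by rw [h34, h12]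
  have ha12 : ∑ i, ∑ j, Gi j i * S Y X (b j) (b i) = ∑ i, ∑ j, Gi j i * S X Y (b j) (b i) :=
    Finset.sum_congr rfl fun i _ ↦ Finset.sum_congr rfl fun j _ ↦ by rw [h12]
  have ha10 : ∑ i, ∑ j, Gi j i * S Y (b j) (b i) X = ∑ i, ∑ j, Gi j i * S (b i) Y (b j) X := by
    rw [hswap (fun i j ↦ S Y (b j) (b i) X)]
    exact Finset.sum_congr rfl fun i _ ↦ Finset.sum_congr rfl fun j _ ↦ by rw [h34, h12, h34]
  have ha11 : ∑ i, ∑ j, Gi j i * S Y (b i) X (b j) = ∑ i, ∑ j, Gi j i * S (b i) Y (b j) X :=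
    Finset.sum_congr rfl fun i _ ↦ Finset.sum_congr rfl fun j _ ↦ by rw [h12, h34]
  simp only [mul_add, mul_sub, Finset.sum_add_distrib, Finset.sum_sub_distrib]
  linear_combination (3 / 2 : ℝ) * ha4 - (1 / 2 : ℝ) * ha6 - (1 / 2 : ℝ) * ha12
    + (1 / 2 : ℝ) * ha10 + (1 / 2 : ℝ) * ha11

end Data

/-! ### Calculus of the first-order data -/

section Calculus

variable {E : Type*} [NormedAddCommGroup E] [NormedSpace ℝ E]
  {ι : Type*} [Fintype ι] [DecidableEq ι]

/-- **Derivative of the entries of the inverse of a matrix of `C¹` functions**: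
`∂_V (A⁻¹)ⱼᵢ = -(A⁻¹ (∂_V A) A⁻¹)ⱼᵢ` where `det A ≠ 0` (differentiate `A A⁻¹ = 1`, which holds
near the point, and multiply by `A⁻¹`). [folklore] -/
theorem fderiv_matrix_inv_apply {A : E → Matrix ι ι ℝ} {x : E}
    (hA : ∀ i j, ContDiffAt ℝ 1 (fun y ↦ A y i j) x) (h0 : (A x).det ≠ 0) (V : E) (j i : ι) :
    fderiv ℝ (fun y ↦ (A y)⁻¹ j i) x V =
      -∑ a, ∑ c, (A x)⁻¹ j a * fderiv ℝ (fun y ↦ A y a c) x V * (A x)⁻¹ c i := by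
  have hAd : ∀ i j, DifferentiableAt ℝ (fun y ↦ A y i j) x := fun i j ↦
    (hA i j).differentiableAt one_ne_zero
  have hAi : ∀ i j, DifferentiableAt ℝ (fun y ↦ (A y)⁻¹ i j) x := by
    intro i j
    have h := contMDiffAt_matrix_inv (I := 𝓘(ℝ, E)) (k := 1) (A := A) (x₀ := x)
      (fun i j ↦ contMDiffAt_iff_contDiffAt.2 (hA i j)) h0 i j
    exact (contMDiffAt_iff_contDiffAt.1 h).differentiableAt one_ne_zero
  -- `det (A y) ≠ 0` near `x`
  have hcont : ContinuousAt (fun y ↦ (A y).det) x := by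
    have hc : ContinuousAt A x :=
      continuousAt_pi.2 fun i ↦ continuousAt_pi.2 fun j ↦ (hAd i j).continuousAt
    exact (continuous_id.matrix_det.continuousAt).comp hc
  have hev : ∀ᶠ y in 𝓝 x, (A y).det ≠ 0 := hcont.eventually_ne h0
  -- the derivative matrices in the direction `V`
  set DA : Matrix ι ι ℝ := Matrix.of fun p q ↦ fderiv ℝ (fun y ↦ A y p q) x V with hDA
  set DB : Matrix ι ι ℝ := Matrix.of fun p q ↦ fderiv ℝ (fun y ↦ (A y)⁻¹ p q) x V with hDB
  -- product rule on `(A A⁻¹)_{pq} = δ_{pq}` near `x`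
  have hprod : A x * DB + DA * (A x)⁻¹ = 0 := by
    ext p q
    have hf : (fun y ↦ ∑ a, A y p a * (A y)⁻¹ a q) =ᶠ[𝓝 x]
        fun _ ↦ (if p = q then 1 else 0 : ℝ) := by
      filter_upwards [hev] with y hy
      have h1 : (A y * (A y)⁻¹) p q = (1 : Matrix ι ι ℝ) p q := by
        rw [Matrix.mul_nonsing_inv _ (Ne.isUnit hy)]
      rwa [Matrix.mul_apply, Matrix.one_apply] at h1
    have hzero : fderiv ℝ (fun y ↦ ∑ a, A y p a * (A y)⁻¹ a q) x V = 0 := by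
      rw [hf.fderiv_eq, fderiv_const_apply]
      rfl
    have hsum : fderiv ℝ (fun y ↦ ∑ a, A y p a * (A y)⁻¹ a q) x V =
        ∑ a, (A x p a * fderiv ℝ (fun y ↦ (A y)⁻¹ a q) x V
          + (A x)⁻¹ a q * fderiv ℝ (fun y ↦ A y p a) x V) := by
      rw [fderiv_fun_sum (A := fun a y ↦ A y p a * (A y)⁻¹ a q)
        (fun a _ ↦ by exact (hAd p a).mul (hAi a q)), FunLike.coe_sum,
        Finset.sum_apply]
      refine Finset.sum_congr rfl fun a _ ↦ ?_
      rw [fderiv_fun_mul (hAd p a) (hAi a q)]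
      simp only [_root_.add_apply, FunLike.coe_smul, Pi.smul_apply,
        smul_eq_mul]
    rw [hsum] at hzero
    simp only [Matrix.add_apply, Matrix.mul_apply, hDA, hDB, Matrix.of_apply, Matrix.zero_apply,
      ← Finset.sum_add_distrib]
    rw [← hzero]
    refine Finset.sum_congr rfl fun a _ ↦ ?_
    ring
  -- solve for `DB`
  have hunit : IsUnit (A x).det := Ne.isUnit h0
  have hDBeq : DB = -((A x)⁻¹ * DA * (A x)⁻¹) := by
    have h1 : A x * DB = -(DA * (A x)⁻¹) := eq_neg_of_add_eq_zero_left hprod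
    calc DB = (A x)⁻¹ * (A x * DB) := by
          rw [← Matrix.mul_assoc, Matrix.nonsing_inv_mul _ hunit, Matrix.one_mul]
      _ = -((A x)⁻¹ * DA * (A x)⁻¹) := by rw [h1, Matrix.mul_neg, Matrix.mul_assoc]
  have h := congrFun (congrFun hDBeq j) i
  simp only [hDB, Matrix.of_apply, Matrix.neg_apply] at h
  rw [h]
  simp only [Matrix.mul_apply, hDA, Matrix.of_apply, Finset.sum_mul]
  rw [Finset.sum_comm]

omit [Fintype ι] [DecidableEq ι] in
/-- Derivative of a metric component evaluated on a moving vector: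
`∂_V [G(c(·), Z)] = DG(V)(c, Z) + G(∂_V c, Z)`. [folklore] -/
theorem fderiv_apply_moving {G : E → E →L[ℝ] E →L[ℝ] ℝ} {c : E → E} {x : E}
    (hG : DifferentiableAt ℝ G x) (hc : DifferentiableAt ℝ c x) (Z V : E) :
    fderiv ℝ (fun y ↦ G y (c y) Z) x V = fderiv ℝ G x V (c x) Z + G x (fderiv ℝ c x V) Z := by
  have h1 : HasFDerivAt (fun y ↦ G y (c y)) ((G x).comp (fderiv ℝ c x) + (fderiv ℝ G x).flip (c x))
      x := hG.hasFDerivAt.clm_apply hc.hasFDerivAt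
  have h2 : HasFDerivAt (fun y ↦ G y (c y) Z)
      (((G x) (c x)).comp (0 : E →L[ℝ] E) +
        ((G x).comp (fderiv ℝ c x) + (fderiv ℝ G x).flip (c x)).flip Z) x :=
    h1.clm_apply (hasFDerivAt_const Z x)
  rw [h2.fderiv]
  simp only [_root_.add_apply, ContinuousLinearMap.comp_zero, zero_add,
    ContinuousLinearMap.flip_apply, ContinuousLinearMap.coe_comp, Function.comp_apply]
  ring

omit [Fintype ι] [DecidableEq ι] in
/-- Differentiability of a metric component evaluated on a moving vector. [folklore] -/
theorem differentiableAt_apply_moving {G : E → E →L[ℝ] E →L[ℝ] ℝ} {c : E → E} {x : E}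
    (hG : DifferentiableAt ℝ G x) (hc : DifferentiableAt ℝ c x) (Z : E) :
    DifferentiableAt ℝ (fun y ↦ G y (c y) Z) x :=
  (hG.clm_apply hc).clm_apply (differentiableAt_const Z)

/-- The entries of the inverse Gram matrix of `C¹` components are differentiable where the Gram
determinant does not vanish. [folklore] -/
theorem differentiableAt_gramInv_apply (b : Module.Basis ι ℝ E) {G : E → E →L[ℝ] E →L[ℝ] ℝ}
    {x : E} (hG1 : ContDiffAt ℝ 1 G x) (h0 : (Matrix.of fun i j ↦ G x (b i) (b j)).det ≠ 0)
    (j i : ι) : DifferentiableAt ℝ (fun y ↦ gramInv b (G y) j i) x := by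
  have hA1 : ∀ i j, ContDiffAt ℝ 1 (fun y ↦ (Matrix.of fun i j ↦ G y (b i) (b j)) i j) x :=
    fun i j ↦ (hG1.clm_apply contDiffAt_const).clm_apply contDiffAt_const
  have h := contMDiffAt_matrix_inv (I := 𝓘(ℝ, E)) (k := 1)
    (A := fun y ↦ Matrix.of fun i j ↦ G y (b i) (b j)) (x₀ := x)
    (fun i j ↦ contMDiffAt_iff_contDiffAt.2 (hA1 i j)) h0 j i
  exact (contMDiffAt_iff_contDiffAt.1 h).differentiableAt one_ne_zero

/-- `y ↦ W♭(Z)(y)` is differentiable at a `C²` point with nondegenerate Gram matrix and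
differentiable background components. [folklore] -/
theorem differentiableAt_wflatFun (b : Module.Basis ι ℝ E) {G : E → E →L[ℝ] E →L[ℝ] ℝ}
    {Cb : E → E → E → E} {x : E} (hG2 : ContDiffAt ℝ 2 G x)
    (h0 : (Matrix.of fun i j ↦ G x (b i) (b j)).det ≠ 0)
    (hC : ∀ i j, DifferentiableAt ℝ (fun y ↦ Cb y (b i) (b j)) x) (Z : E) :
    DifferentiableAt ℝ (fun y ↦ wflatFun b G Cb y Z) x := by
  have hGd : DifferentiableAt ℝ G x := hG2.differentiableAt two_ne_zero
  have hsum : (fun y ↦ wflatFun b G Cb y Z) = fun y ↦ ∑ i, ∑ j, gramInv b (G y) j i *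
      (2⁻¹ * koszulForm G y (b i) (b j) Z - G y (Cb y (b i) (b j)) Z) := by
    funext y
    simp only [wflatFun, wflat, kos_fderiv]
  rw [hsum]
  refine DifferentiableAt.fun_sum fun i _ ↦ DifferentiableAt.fun_sum fun j _ ↦ ?_
  exact (differentiableAt_gramInv_apply b (hG2.of_le one_le_two) h0 j i).mul
    (((differentiableAt_koszulForm hG2 _ _ _).const_mul _).sub
      (differentiableAt_apply_moving hGd (hC i j) Z))

/-- **The derivative of `W♭(Z)` along `E`.** At a point where `G` is `C²` with nondegenerate
Gram matrix and the background Christoffel components are differentiable,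
`∂_V W♭(Z) = ∑ᵢⱼ [∂_V gʲⁱ (½ K(bᵢ,bⱼ,Z) - G(Γ̃ᵢⱼ, Z)) + gʲⁱ (½ ∂_V K(bᵢ,bⱼ,Z) - DG(V)(Γ̃ᵢⱼ, Z)
  - G(∂_V Γ̃ᵢⱼ, Z))]` with `∂_V gʲⁱ = dGramInv …` (`fderiv_matrix_inv_apply`). The only second
derivatives of `G` are in `∂_V K`. [folklore] -/
theorem fderiv_wflatFun (b : Module.Basis ι ℝ E) {G : E → E →L[ℝ] E →L[ℝ] ℝ} {Cb : E → E → E → E}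
    {x : E} (hG2 : ContDiffAt ℝ 2 G x) (h0 : (Matrix.of fun i j ↦ G x (b i) (b j)).det ≠ 0)
    (hC : ∀ i j, DifferentiableAt ℝ (fun y ↦ Cb y (b i) (b j)) x) (Z V : E) :
    fderiv ℝ (fun y ↦ wflatFun b G Cb y Z) x V =
      ∑ i, ∑ j, (dGramInv b (gramInv b (G x)) (fderiv ℝ G x) V j i *
          (2⁻¹ * kos (fderiv ℝ G x) (b i) (b j) Z - G x (Cb x (b i) (b j)) Z)
        + gramInv b (G x) j i *
          (2⁻¹ * fderiv ℝ (fun y ↦ koszulForm G y (b i) (b j) Z) x V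
            - (fderiv ℝ G x V (Cb x (b i) (b j)) Z
              + G x (fderiv ℝ (fun y ↦ Cb y (b i) (b j)) x V) Z))) := by
  have hGd : DifferentiableAt ℝ G x := hG2.differentiableAt two_ne_zero
  -- the Gram matrix as a function and the derivative of its inverse
  set A : E → Matrix ι ι ℝ := fun y ↦ Matrix.of fun i j ↦ G y (b i) (b j) with hA
  have hA1 : ∀ i j, ContDiffAt ℝ 1 (fun y ↦ A y i j) x := fun i j ↦
    ((hG2.clm_apply contDiffAt_const).clm_apply contDiffAt_const).of_le one_le_two
  have hGi : ∀ y, gramInv b (G y) = (A y)⁻¹ := fun y ↦ rfl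
  have hGid : ∀ j i, DifferentiableAt ℝ (fun y ↦ gramInv b (G y) j i) x := fun j i ↦
    differentiableAt_gramInv_apply b (hG2.of_le one_le_two) h0 j i
  have hGi' : ∀ j i, fderiv ℝ (fun y ↦ gramInv b (G y) j i) x V =
      dGramInv b (gramInv b (G x)) (fderiv ℝ G x) V j i := by
    intro j i
    simp only [hGi]
    rw [fderiv_matrix_inv_apply hA1 h0 V j i, dGramInv, Matrix.of_apply]
    congr 1
    refine Finset.sum_congr rfl fun a _ ↦ Finset.sum_congr rfl fun c _ ↦ ?_
    simp only [hA, Matrix.of_apply, fderiv_apply₂ G hGd]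
  -- the bracket `f_ij(y) = ½ K(bᵢ,bⱼ,Z) - G(Γ̃ᵢⱼ, Z)` and its derivative
  have hK : ∀ i j, DifferentiableAt ℝ (fun y ↦ koszulForm G y (b i) (b j) Z) x := fun i j ↦
    differentiableAt_koszulForm hG2 _ _ _
  have hM : ∀ i j, DifferentiableAt ℝ (fun y ↦ G y (Cb y (b i) (b j)) Z) x := fun i j ↦
    differentiableAt_apply_moving hGd (hC i j) Z
  have hf : ∀ i j, DifferentiableAt ℝ
      (fun y ↦ 2⁻¹ * koszulForm G y (b i) (b j) Z - G y (Cb y (b i) (b j)) Z) x := fun i j ↦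
    ((hK i j).const_mul _).sub (hM i j)
  have hf' : ∀ i j, fderiv ℝ (fun y ↦ 2⁻¹ * koszulForm G y (b i) (b j) Z - G y (Cb y (b i) (b j)) Z)
      x V = 2⁻¹ * fderiv ℝ (fun y ↦ koszulForm G y (b i) (b j) Z) x V
        - (fderiv ℝ G x V (Cb x (b i) (b j)) Z + G x (fderiv ℝ (fun y ↦ Cb y (b i) (b j)) x V) Z) := by
    intro i j
    rw [fderiv_fun_sub ((hK i j).const_mul _) (hM i j), fderiv_const_mul (hK i j),
      _root_.sub_apply, FunLike.coe_smul, Pi.smul_apply, smul_eq_mul,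
      fderiv_apply_moving hGd (hC i j)]
  -- assemble
  have hterm : ∀ i j, fderiv ℝ (fun y ↦ gramInv b (G y) j i *
      (2⁻¹ * koszulForm G y (b i) (b j) Z - G y (Cb y (b i) (b j)) Z)) x V =
      dGramInv b (gramInv b (G x)) (fderiv ℝ G x) V j i *
          (2⁻¹ * kos (fderiv ℝ G x) (b i) (b j) Z - G x (Cb x (b i) (b j)) Z)
        + gramInv b (G x) j i *
          (2⁻¹ * fderiv ℝ (fun y ↦ koszulForm G y (b i) (b j) Z) x V
            - (fderiv ℝ G x V (Cb x (b i) (b j)) Z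
              + G x (fderiv ℝ (fun y ↦ Cb y (b i) (b j)) x V) Z)) := by
    intro i j
    rw [fderiv_fun_mul (hGid j i) (hf i j), _root_.add_apply, FunLike.coe_smul,
      FunLike.coe_smul, Pi.smul_apply, Pi.smul_apply, smul_eq_mul, smul_eq_mul,
      hf' i j, hGi' j i, kos_fderiv]
    ring
  have hsum : (fun y ↦ wflatFun b G Cb y Z) = fun y ↦ ∑ i, ∑ j, gramInv b (G y) j i *
      (2⁻¹ * koszulForm G y (b i) (b j) Z - G y (Cb y (b i) (b j)) Z) := by
    funext y
    simp only [wflatFun, wflat, kos_fderiv]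
  rw [hsum, fderiv_fun_sum fun i _ ↦ ?_, FunLike.coe_sum, Finset.sum_apply]
  · refine Finset.sum_congr rfl fun i _ ↦ ?_
    rw [fderiv_fun_sum fun j _ ↦ ?_, FunLike.coe_sum, Finset.sum_apply]
    · exact Finset.sum_congr rfl fun j _ ↦ hterm i j
    · exact (hGid j i).mul (hf i j)
  · exact DifferentiableAt.fun_sum fun j _ ↦ (hGid j i).mul (hf i j)

omit [Fintype ι] [DecidableEq ι] in
/-- Symmetry of second derivatives of the components: `D²G(x)(V, A) = D²G(x)(A, V)` at a `C²`
point (Mathlib's `ContDiffAt.isSymmSndFDerivAt`). [folklore] -/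
theorem fderiv_fderiv_symm₁₂ {G : E → E →L[ℝ] E →L[ℝ] ℝ} {x : E} (hG2 : ContDiffAt ℝ 2 G x)
    (V A B C : E) : fderiv ℝ (fderiv ℝ G) x V A B C = fderiv ℝ (fderiv ℝ G) x A V B C := by
  rw [hG2.isSymmSndFDerivAt (by simp) V A]

omit [Fintype ι] [DecidableEq ι] in
/-- The second derivative of symmetric components is symmetric in the form slots:
`D²G(x)(V, A)(B, C) = D²G(x)(V, A)(C, B)` if `G` is symmetric near `x`
(`fderiv_fderiv_bilin_apply_eq`: second derivatives of the components are components of the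
second derivative). [folklore] -/
theorem fderiv_fderiv_symm₃₄ {G : E → E →L[ℝ] E →L[ℝ] ℝ} {x : E} (hG2 : ContDiffAt ℝ 2 G x)
    (hsymm : ∀ᶠ y in 𝓝 x, ∀ B C, G y B C = G y C B) (V A B C : E) :
    fderiv ℝ (fderiv ℝ G) x V A B C = fderiv ℝ (fderiv ℝ G) x V A C B := by
  rw [fderiv_fderiv_bilin_apply_eq hG2, fderiv_fderiv_bilin_apply_eq hG2]
  have h : (fun z ↦ G z B C) =ᶠ[𝓝 x] fun z ↦ G z C B := hsymm.mono fun y hy ↦ hy B C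
  have h' : (fun y ↦ fderiv ℝ (fun z ↦ G z B C) y A) =ᶠ[𝓝 x]
      fun y ↦ fderiv ℝ (fun z ↦ G z C B) y A := by
    filter_upwards [h.fderiv (𝕜 := ℝ)] with y hy
    rw [hy]
  rw [h'.fderiv_eq]

/-- **The derivative of `W♭(Z)` split into its second-order and first-order parts**:
`∂_V W♭(Z) = ½ gʲⁱ ∂_V K(bᵢ, bⱼ, Z) + lieLowerHalf`, the `∂_V K` written out as second
derivatives `D²G` (`fderiv_wflatFun`, `fderiv_koszulForm_eq`). [folklore] -/
theorem fderiv_wflatFun_split (b : Module.Basis ι ℝ E) {G : E → E →L[ℝ] E →L[ℝ] ℝ}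
    {Cb : E → E → E → E} {x : E} (hG2 : ContDiffAt ℝ 2 G x)
    (h0 : (Matrix.of fun i j ↦ G x (b i) (b j)).det ≠ 0)
    (hC : ∀ i j, DifferentiableAt ℝ (fun y ↦ Cb y (b i) (b j)) x) (Z V : E) :
    fderiv ℝ (fun y ↦ wflatFun b G Cb y Z) x V =
      2⁻¹ * (∑ i, ∑ j, gramInv b (G x) j i *
          (fderiv ℝ (fderiv ℝ G) x V (b j) (b i) Z + fderiv ℝ (fderiv ℝ G) x V (b i) Z (b j)
            - fderiv ℝ (fderiv ℝ G) x V Z (b j) (b i)))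
        + lieLowerHalf b (G x) (gramInv b (G x)) (fderiv ℝ G x) (Cb x)
            (fun V Y₀ X₀ ↦ fderiv ℝ (fun y ↦ Cb y Y₀ X₀) x V) V Z := by
  rw [fderiv_wflatFun b hG2 h0 hC Z V, lieLowerHalf, Finset.mul_sum, ← Finset.sum_add_distrib]
  refine Finset.sum_congr rfl fun i _ ↦ ?_
  rw [Finset.mul_sum, ← Finset.sum_add_distrib]
  refine Finset.sum_congr rfl fun j _ ↦ ?_
  rw [fderiv_koszulForm_eq hG2]
  ring

end Calculus

/-! ### Layer 1: identification of the data on `U : Opens E` -/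

section Ident

variable {E : Type*} [NormedAddCommGroup E] [NormedSpace ℝ E] [FiniteDimensional ℝ E]
  [CompleteSpace E] {U : Opens E}
  {g : PseudoRiemannianMetric 𝓘(ℝ, E) ∞ E (TangentSpace 𝓘(ℝ, E) : U → Type _)}
  {G : E → E →L[ℝ] E →L[ℝ] ℝ} (hG : ∀ y : U, g.val y = G y)
  {ι : Type*} [Fintype ι] [DecidableEq ι] (b : Module.Basis ι ℝ E)

omit hG in
/-- The basis `b` of `E` regarded as a basis of the tangent space `T_x U = E` (the two types are
definitionally equal, but instance paths differ, so the fibrewise lemmas of the tree are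
instantiated with this copy). [folklore] -/
def basisT (x : U) : Module.Basis ι ℝ (TangentSpace 𝓘(ℝ, E) x) := b

omit [FiniteDimensional ℝ E] [CompleteSpace E] [Fintype ι] [DecidableEq ι] in
/-- `basisT b x i = b i`. [folklore] -/
@[simp]
theorem basisT_apply (x : U) (i : ι) : (basisT b x i : E) = b i := rfl

include hG

omit [FiniteDimensional ℝ E] [CompleteSpace E] [Fintype ι] [DecidableEq ι] in
/-- The Gram matrix of `g` at `x` in the basis `b` is that of the components `G x`. [folklore] -/
theorem gram_eq (x : U) :
    (Matrix.of fun i j ↦ g.val x (basisT b x i) (basisT b x j)) =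
      Matrix.of fun i j ↦ G x (b i) (b j) := by
  ext i j
  simp only [Matrix.of_apply, hG x]
  rfl

omit [FiniteDimensional ℝ E] [CompleteSpace E] in
/-- The inverse Gram matrix of `g` at `x` is `gramInv b (G x)`. [folklore] -/
theorem gram_inv_eq_gramInv (x : U) :
    (Matrix.of fun i j ↦ g.val x (basisT b x i) (basisT b x j))⁻¹ = gramInv b (G x) := by
  rw [gram_eq hG b x, gramInv]

omit hG in
/-- The bilinear form `(v, w) ↦ D(v, w)(X₀, Y₀)` on `T_x U = E` cut out of a second derivative
`D = D²G(x)` of metric components (`sndDerivFormE` at the tangent space; an auxiliary for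
`principal_eq_trace`). [folklore] -/
def sndDerivForm (x : U) (D : E →L[ℝ] E →L[ℝ] E →L[ℝ] E →L[ℝ] ℝ) (X₀ Y₀ : E) :
    LinearMap.BilinForm ℝ (TangentSpace 𝓘(ℝ, E) x) :=
  (sndDerivFormE D X₀ Y₀ : LinearMap.BilinForm ℝ E)

omit [CompleteSpace E] in
/-- **The principal part is the metric trace of the second derivative**: for a basis `b`,
`∑ᵢⱼ gʲⁱ D²G(x)(bᵢ, bⱼ)(X₀, Y₀) = tr_g [(v, w) ↦ D²G(x)(v, w)(X₀, Y₀)] = gᵖ𐞥 ∂_p∂_q G(X₀, Y₀)`;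
in particular it does not depend on `b`, and its symbol in the codirection `ξ` is
`gᵖ𐞥 ξ_p ξ_q = |ξ|²_g` times the identity (strict parabolicity; Andrews–Hopper 2011, (5.9)).
[cite: AndrewsHopper2011, §5.4.1, (5.9)] -/
theorem principal_eq_trace (x : U) (X₀ Y₀ : E) :
    ∑ i, ∑ j, gramInv b (G x) j i * fderiv ℝ (fderiv ℝ G) x (b i) (b j) X₀ Y₀ =
      g.trace x (sndDerivForm x (fderiv ℝ (fderiv ℝ G) x) X₀ Y₀) := by
  rw [trace_eq_sum_gram_inv g x (basisT b x), gram_inv_eq_gramInv hG b x]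
  refine Finset.sum_congr rfl fun i _ ↦ Finset.sum_congr rfl fun j _ ↦ ?_
  rfl

omit [CompleteSpace E] in
/-- **The Christoffel map through the data**: `Γ_x(X₀, Y₀) = chris b (g⁻¹) (DG x) Y₀ X₀`
(`sharp_eq_sum`). [cite: ONeill1983, Ch. 3, Prop. 3.13] -/
theorem christoffel_eq_chris (x : U) (Y₀ X₀ : E) :
    christoffel g G x Y₀ X₀ = chris b (gramInv b (G x)) (fderiv ℝ G x) Y₀ X₀ := by
  rw [christoffel_apply, sharp_eq_sum g x (basisT b x), gram_inv_eq_gramInv hG b x, chris]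
  refine Finset.sum_congr rfl fun a _ ↦ ?_
  simp only [basisT_apply, kos_fderiv]
  rfl

/-! ### The DeTurck vector field in coordinates -/

variable (bg : CovariantDerivative 𝓘(ℝ, E) E (TangentSpace 𝓘(ℝ, E) : U → Type _))
  {Cb : E → E → E → E}
  (hCb : ∀ (y : U) (Y₀ X₀ : E), (bg (fun _ : U ↦ (Y₀ : E)) y X₀ : E) = Cb y Y₀ X₀)

include hCb

omit hG hCb [CompleteSpace E] [Fintype ι] [DecidableEq ι] in
/-- **The difference tensor of the Levi-Civita connection and a background connection, on
constant fields**: `A_x(Y₀)(X₀) = ∇_{X₀} Y₀ - ∇̃_{X₀} Y₀` for the constant field `Y₀` (Mathlib's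
`difference_apply` on the constant section). [cite: AndrewsHopper2011, §5.4.1, (5.7)] -/
theorem difference_const_apply [g.HasLeviCivita] (x : U) (Y₀ X₀ : E) :
    g.leviCivita.difference bg x Y₀ X₀ =
      g.leviCivita (fun _ : U ↦ (Y₀ : E)) x X₀ - bg (fun _ : U ↦ (Y₀ : E)) x X₀ := by
  set Yc : Π y : U, TangentSpace 𝓘(ℝ, E) y := fun _ ↦ (Y₀ : E) with hYc
  have hY : MDiffAt (T% Yc) x := mdifferentiableAt_const_section x Y₀
  have h := IsCovariantDerivativeOn.difference_apply (x := x)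
    g.leviCivita.isCovariantDerivativeOnUniv bg.isCovariantDerivativeOnUniv (σ := Yc)
    (by trivial) hY
  have h' := congrArg (fun f ↦ f X₀) h
  simp only [_root_.sub_apply] at h'
  exact h'

omit [CompleteSpace E] [Fintype ι] [DecidableEq ι] in
/-- **The difference tensor paired with the metric, in coordinates**:
`g_x(A(Y₀)(X₀), Z) = ½ K(Y₀, X₀, Z) - G_x(Γ̃_x(X₀, Y₀), Z)`, where `Γ̃_x(X₀, Y₀) = Cb x Y₀ X₀`
represents the background connection on the constant field `Y₀` and `2 g(Γ(X₀, Y₀), Z) = K`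
(`leviCivita_const_apply`, `val_christoffel_const`). [cite: AndrewsHopper2011, §5.4.1, (5.7)] -/
theorem val_difference_const [g.HasLeviCivita] (x : U) (Y₀ X₀ Z : E) :
    g.val x (g.leviCivita.difference bg x Y₀ X₀) Z =
      2⁻¹ * koszulForm G x Y₀ X₀ Z - G x (Cb x Y₀ X₀) Z := by
  rw [difference_const_apply bg x Y₀ X₀, map_sub, _root_.sub_apply,
    leviCivita_const_apply hG x (differentiableAt_repr hG x) Y₀ X₀,
    val_christoffel_const (g := g) (G := G) x Y₀ X₀ Z, hCb x Y₀ X₀, hG x]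
  rfl

omit [CompleteSpace E] in
/-- **The metric dual of the DeTurck vector field in coordinates**:
`g_x(W, Z) = gʲⁱ (½ K(bᵢ, bⱼ, Z) - G_x(Γ̃(bⱼ, bᵢ), Z)) = wflat b (G x) g⁻¹ (DG x) (Γ̃ x) Z`
(`W = tr_g A`, `val_traceVec`, the metric trace in the basis `b`, `val_difference_const`).
[cite: AndrewsHopper2011, §5.4.1, (5.7)] -/
theorem val_deTurckField_eq_wflat [g.HasLeviCivita] (x : U) (Z : E) :
    g.val x (deTurckField g g.leviCivita bg x) Z = wflatFun b G Cb x Z := by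
  rw [deTurckField, val_traceVec, trace_eq_sum_gram_inv g x (basisT b x),
    gram_inv_eq_gramInv hG b x, wflatFun, wflat]
  refine Finset.sum_congr rfl fun i _ ↦ Finset.sum_congr rfl fun j _ ↦ ?_
  rw [bilinFormOfVec_apply, basisT_apply, basisT_apply,
    val_difference_const hG bg hCb x (b i) (b j) Z, kos_fderiv]

omit [CompleteSpace E] in
/-- **The DeTurck vector field in coordinates**: `W_x = ∑ₐ (∑_c g^{ca} W♭(b_c)) bₐ` with
`W♭ = wflat …` (index raising in the basis `b`, `sharp_eq_sum`). This exhibits a representative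
of `W` as an explicit function of the first-order data of `g` along `U`.
[cite: AndrewsHopper2011, §5.4.1, (5.7)] -/
theorem deTurckField_eq_sum [g.HasLeviCivita] (x : U) :
    (deTurckField g g.leviCivita bg x : E) =
      ∑ a, (∑ c, gramInv b (G x) c a * wflatFun b G Cb x (b c)) • b a := by
  have h := sharp_eq_sum g x (basisT b x) (traceVecDual g x (g.leviCivita.difference bg x))
  rw [deTurckField, traceVec, h, gram_inv_eq_gramInv hG b x]
  refine Finset.sum_congr rfl fun a _ ↦ ?_
  have hc : ∀ c, traceVecDual g x (g.leviCivita.difference bg x) (basisT b x c) =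
      wflatFun b G Cb x (b c) := fun c ↦ by
    rw [traceVecDual_apply, ← val_traceVec]
    exact val_deTurckField_eq_wflat hG b bg hCb x (b c)
  simp only [hc]
  rfl

/-! ### The Lie derivative term in coordinates -/

omit [FiniteDimensional ℝ E] [CompleteSpace E] hCb in
/-- The Gram determinant of the components of `g` in the basis `b` does not vanish on `U`.
[folklore] -/
theorem det_gram_repr_ne_zero (x : U) : (Matrix.of fun i j ↦ G x (b i) (b j)).det ≠ 0 := by
  rw [← gram_eq hG b x]
  exact det_gram_ne_zero g x (basisT b x)

omit [FiniteDimensional ℝ E] [CompleteSpace E] [Fintype ι] [DecidableEq ι] hCb in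
/-- The components of `g` are `C²` at the points of `U`. [folklore] -/
theorem contDiffAt_two_repr (x : U) : ContDiffAt ℝ 2 G x :=
  (contDiffAt_repr hG x).of_le (WithTop.coe_le_coe.mpr le_top)

omit [CompleteSpace E] in
/-- **The DeTurck vector field is a differentiable section** of `TU` (at a point where the
background Christoffel components are differentiable), with the explicit representative of
`deTurckField_eq_sum`. [folklore] -/
theorem mdifferentiableAt_deTurckField [g.HasLeviCivita] (x : U)
    (hCd : ∀ i j, DifferentiableAt ℝ (fun y : E ↦ Cb y (b i) (b j)) x) :
    MDiffAt (T% (fun y : U ↦ deTurckField g g.leviCivita bg y)) x := by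
  set Wf : E → E := fun y ↦ ∑ a, (∑ c, gramInv b (G y) c a * wflatFun b G Cb y (b c)) • b a
    with hWf
  have hWrep : ∀ y : U, (deTurckField g g.leviCivita bg y : E) = Wf y := fun y ↦
    deTurckField_eq_sum hG b bg hCb y
  have h0 := det_gram_repr_ne_zero hG b x
  have hG2 := contDiffAt_two_repr hG x
  have hWfd : DifferentiableAt ℝ Wf x := by
    refine DifferentiableAt.fun_sum fun a _ ↦ ?_
    refine (DifferentiableAt.fun_sum fun c _ ↦ ?_).smul_const (b a)
    exact (differentiableAt_gramInv_apply b (hG2.of_le one_le_two) h0 c a).mul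
      (differentiableAt_wflatFun b hG2 h0 hCd (b c))
  exact (mdifferentiableAt_section_iff x _).2 ((mdifferentiableAt_iff x _ Wf hWrep).2 hWfd)

/-- **Metric compatibility applied to the DeTurck field**: for constant `X₀, Y₀`,
`g(∇_{X₀} W, Y₀) = ∂_{X₀} [g(W, Y₀)] - g(W, ∇_{X₀} Y₀) = ∂_{X₀} W♭(Y₀) - W♭(Γ(X₀, Y₀))`
(O'Neill 1983, Ch. 3, Thm. 3.11 (D4)). [cite: ONeill1983, Ch. 3, Thm. 3.11] -/
theorem val_leviCivita_deTurckField [g.HasLeviCivita] (x : U)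
    (hCd : ∀ i j, DifferentiableAt ℝ (fun y : E ↦ Cb y (b i) (b j)) x) (X₀ Y₀ : E) :
    g.val x (g.leviCivita (fun y : U ↦ deTurckField g g.leviCivita bg y) x X₀) Y₀ =
      fderiv ℝ (fun y ↦ wflatFun b G Cb y Y₀) x X₀
        - wflatFun b G Cb x (christoffel g G x Y₀ X₀) := by
  have hLC : g.IsLeviCivita g.leviCivita := g.isLeviCivita_leviCivita_holds
  set W : Π y : U, TangentSpace 𝓘(ℝ, E) y := fun y ↦ deTurckField g g.leviCivita bg y with hW
  set Xc : Π y : U, TangentSpace 𝓘(ℝ, E) y := fun _ ↦ (X₀ : E) with hXc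
  set Yc : Π y : U, TangentSpace 𝓘(ℝ, E) y := fun _ ↦ (Y₀ : E) with hYc
  have hWd : MDiffAt (T% W) x := mdifferentiableAt_deTurckField hG b bg hCb x hCd
  have hc := hLC.2 (x := x) (X := Xc) (Y := W) (Z := Yc) (mdifferentiableAt_const_section x X₀)
    hWd (mdifferentiableAt_const_section x Y₀)
  have hrep : ∀ y : U, g.val y (W y) (Yc y) = (fun z : E ↦ wflatFun b G Cb z Y₀) y := fun y ↦
    val_deTurckField_eq_wflat hG b bg hCb y Y₀
  have hdiff : DifferentiableAt ℝ (fun z : E ↦ wflatFun b G Cb z Y₀) x :=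
    differentiableAt_wflatFun b (contDiffAt_two_repr hG x) (det_gram_repr_ne_zero hG b x) hCd Y₀
  rw [mvfderiv_eq x _ _ hrep hdiff] at hc
  simp only [hXc, hYc] at hc
  rw [leviCivita_const_const_apply hG x Y₀ X₀, val_deTurckField_eq_wflat hG b bg hCb x] at hc
  simp only [hW]
  linarith

/-- **The Lie derivative term of the Ricci–DeTurck operator in coordinates**:
`ℒ_W g (X₀, Y₀) = g(∇_{X₀} W, Y₀) + g(X₀, ∇_{Y₀} W)
  = ∂_{X₀} W♭(Y₀) + ∂_{Y₀} W♭(X₀) - W♭(Γ(X₀, Y₀)) - W♭(Γ(Y₀, X₀))`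
(Andrews–Hopper 2011, (5.10): `∇ᵢWⱼ + ∇ⱼWᵢ`). [cite: AndrewsHopper2011, §5.4.2, (5.10)] -/
theorem lieDerivMetric_deTurckField_eq [g.HasLeviCivita] (x : U)
    (hCd : ∀ i j, DifferentiableAt ℝ (fun y : E ↦ Cb y (b i) (b j)) x) (X₀ Y₀ : E) :
    lieDerivMetric g g.leviCivita (deTurckField g g.leviCivita bg) x X₀ Y₀ =
      fderiv ℝ (fun y ↦ wflatFun b G Cb y Y₀) x X₀ + fderiv ℝ (fun y ↦ wflatFun b G Cb y X₀) x Y₀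
        - wflatFun b G Cb x (christoffel g G x Y₀ X₀)
        - wflatFun b G Cb x (christoffel g G x X₀ Y₀) := by
  rw [lieDerivMetric, g.symm x X₀]
  have h₁ := val_leviCivita_deTurckField hG b bg hCb x hCd X₀ Y₀
  have h₂ := val_leviCivita_deTurckField hG b bg hCb x hCd Y₀ X₀
  change g.val x (g.leviCivita (fun y : U ↦ deTurckField g g.leviCivita bg y) x X₀) Y₀ +
    g.val x (g.leviCivita (fun y : U ↦ deTurckField g g.leviCivita bg y) x Y₀) X₀ = _
  rw [h₁, h₂]
  ring

/-! ### The Ricci term in coordinates -/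

omit hCb in
/-- **`-2 Ric` in coordinates, split into its second-order and first-order parts**:
`-2 Ric(X₀, Y₀) = -gʲⁱ (∂_{bᵢ} K(Y₀, X₀, bⱼ) - ∂_{X₀} K(Y₀, bᵢ, bⱼ)) + ricLower`, the `∂K` written
out as second derivatives `D²G` (`ricci_eq_sum`, `val_riemann_eq`, `fderiv_koszulForm_eq`,
`val_christoffel_christoffel_eq_sum`; O'Neill 1983, Ch. 3, Lemma 3.38 and Lemma 3.52).
[cite: ONeill1983, Ch. 3, Lemma 3.38] -/
theorem neg_two_mul_ricci_eq [g.HasLeviCivita] (x : U) (X₀ Y₀ : E) :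
    -2 * g.ricci x X₀ Y₀ =
      -(∑ i, ∑ j, gramInv b (G x) j i *
          ((fderiv ℝ (fderiv ℝ G) x (b i) X₀ Y₀ (b j) + fderiv ℝ (fderiv ℝ G) x (b i) Y₀ (b j) X₀
              - fderiv ℝ (fderiv ℝ G) x (b i) (b j) X₀ Y₀)
            - (fderiv ℝ (fderiv ℝ G) x X₀ (b i) Y₀ (b j) + fderiv ℝ (fderiv ℝ G) x X₀ Y₀ (b j) (b i)
              - fderiv ℝ (fderiv ℝ G) x X₀ (b j) (b i) Y₀)))
      + ricLower b (gramInv b (G x)) (fderiv ℝ G x) X₀ Y₀ := by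
  have hG2 := contDiffAt_two_repr hG x
  have hterm : ∀ i j, g.val x (g.riemann x (basisT b x i) X₀ Y₀) (basisT b x j) =
      2⁻¹ * ((fderiv ℝ (fderiv ℝ G) x (b i) X₀ Y₀ (b j) + fderiv ℝ (fderiv ℝ G) x (b i) Y₀ (b j) X₀
              - fderiv ℝ (fderiv ℝ G) x (b i) (b j) X₀ Y₀)
            - (fderiv ℝ (fderiv ℝ G) x X₀ (b i) Y₀ (b j) + fderiv ℝ (fderiv ℝ G) x X₀ Y₀ (b j) (b i)
              - fderiv ℝ (fderiv ℝ G) x X₀ (b j) (b i) Y₀))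
        - (∑ a, ∑ c, gramInv b (G x) c a * (2⁻¹ * kos (fderiv ℝ G x) (b j) (b i) (b c))
            * (2⁻¹ * kos (fderiv ℝ G x) Y₀ X₀ (b a)))
        + ∑ a, ∑ c, gramInv b (G x) c a * (2⁻¹ * kos (fderiv ℝ G x) (b j) X₀ (b c))
            * (2⁻¹ * kos (fderiv ℝ G x) Y₀ (b i) (b a)) := by
    intro i j
    rw [basisT_apply, basisT_apply, val_riemann_eq hG x (b i) X₀ Y₀ (b j),
      fderiv_koszulForm_eq hG2, fderiv_koszulForm_eq hG2,
      val_christoffel_christoffel_eq_sum hG x (basisT b x),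
      val_christoffel_christoffel_eq_sum hG x (basisT b x)]
    simp only [basisT_apply, kos_fderiv]
    rfl
  rw [ricci_eq_sum g x (basisT b x), gram_inv_eq_gramInv hG b x]
  simp only [hterm]
  have e1 : ∀ p a c d e : ℝ,
      -2 * (p * (2⁻¹ * (a - c) - d + e)) = -(p * (a - c)) + -2 * (p * (-d + e)) := by
    intros
    ring
  rw [ricLower, Finset.mul_sum, Finset.mul_sum, ← Finset.sum_neg_distrib, ← Finset.sum_add_distrib]
  refine Finset.sum_congr rfl fun i _ ↦ ?_
  rw [Finset.mul_sum, Finset.mul_sum, ← Finset.sum_neg_distrib, ← Finset.sum_add_distrib]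
  refine Finset.sum_congr rfl fun j _ ↦ ?_
  rw [e1]

/-! ### The structure theorem -/

/-- **The Ricci–DeTurck operator in coordinates is strictly parabolic with principal part
`gᵖ𐞥 ∂_p ∂_q`** (DeTurck 1983; Andrews–Hopper 2011, §5.4.1, (5.6)–(5.9) and §5.4.2, Step 1:
"From (5.9), the Ricci–DeTurck flow is strictly parabolic"; Topping 2006, §5.2, Step 1:
`σ(DP(g))(x, ξ)h = |ξ|²h`). Exact coordinate form: for a smooth metric `g` on `U : Opens E`
with components `G`, its Levi-Civita connection `∇`, a background connection `∇̃ = bg` whose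
action on constant fields is represented by `Cb` (`∇̃_{X₀} Y₀ (y) = Cb y Y₀ X₀`) with
components differentiable at `x`, the DeTurck field `W = gᵖ𐞥(Γ_{pq} - Γ̃_{pq})`
(`deTurckField`) and a basis `b` of `E` with inverse Gram matrix `(gʲⁱ) = gramInv b (G x)`:
`-2 Ric(X₀, Y₀) + ℒ_W g (X₀, Y₀) = ∑ᵢⱼ gʲⁱ D²G(x)(bᵢ, bⱼ)(X₀, Y₀) + F(x)(X₀, Y₀)`, where the
remainder `F = rdtLower b (G x) g⁻¹ (DG x) (Γ̃ x) (DΓ̃ x)` is the explicit polynomial expression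
`rdtLower` in the FIRST-order data of `G` (and `Γ̃`, `∂Γ̃`) — no second derivative of the
metric enters `F`. Proof: `neg_two_mul_ricci_eq` + `lieDerivMetric_deTurckField_eq` +
`fderiv_wflatFun_split`, and the cancellation `principal_cancel` of all second-order terms
other than `gⁱʲ∂ᵢ∂ⱼ G(X₀, Y₀)`, which uses only the symmetry of `D²G` in its two
differentiation slots and in its two form slots and the symmetry of `gⁱʲ`.
[cite: AndrewsHopper2011, §5.4.1, (5.6)–(5.9)] [cite: DeTurck1983] [cite: Topping2006, §5.2, Step 1] -/
theorem rdt_rhs_eq_coord [g.HasLeviCivita] (x : U)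
    (hCd : ∀ i j, DifferentiableAt ℝ (fun y : E ↦ Cb y (b i) (b j)) x) (X₀ Y₀ : E) :
    -2 * g.ricci x X₀ Y₀ + lieDerivMetric g g.leviCivita (deTurckField g g.leviCivita bg) x X₀ Y₀ =
      (∑ i, ∑ j, gramInv b (G x) j i * fderiv ℝ (fderiv ℝ G) x (b i) (b j) X₀ Y₀)
        + rdtLower b (G x) (gramInv b (G x)) (fderiv ℝ G x) (Cb x)
            (fun V Y₁ X₁ ↦ fderiv ℝ (fun y ↦ Cb y Y₁ X₁) x V) X₀ Y₀ := by
  have hG2 := contDiffAt_two_repr hG x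
  have h0 := det_gram_repr_ne_zero hG b x
  have hsymm : ∀ᶠ y in 𝓝 (x : E), ∀ B C, G y B C = G y C B := by
    filter_upwards [coe_mem_nhds x] with y hy B C
    have h := g.symm ⟨y, hy⟩ B C
    rw [hG ⟨y, hy⟩] at h
    exact h
  have hsymm₀ : ∀ B C, G x B C = G x C B := hsymm.self_of_nhds
  have hpc := principal_cancel b (fun a c d e ↦ fderiv ℝ (fderiv ℝ G) x a c d e)
    (fun a c d e ↦ fderiv_fderiv_symm₁₂ hG2 a c d e)
    (fun a c d e ↦ fderiv_fderiv_symm₃₄ hG2 hsymm a c d e) (gramInv b (G x))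
    (gramInv_symm b hsymm₀) X₀ Y₀
  rw [neg_two_mul_ricci_eq hG b x X₀ Y₀, lieDerivMetric_deTurckField_eq hG b bg hCb x hCd X₀ Y₀,
    fderiv_wflatFun_split b hG2 h0 hCd Y₀ X₀, fderiv_wflatFun_split b hG2 h0 hCd X₀ Y₀,
    christoffel_eq_chris hG b x Y₀ X₀, christoffel_eq_chris hG b x X₀ Y₀, rdtLower]
  simp only [wflatFun]
  linear_combination hpc

/-- **The right-hand side of the Ricci–DeTurck flow in coordinates, for arbitrary Levi-Civita
witnesses.** The Ricci–DeTurck equation of the tree (`IsRicciDeTurckFlow.hasDerivWithinAt`,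
`RicciDeTurckFlow.lean`) is written with an arbitrary Levi-Civita witness `cov` of the metric:
`∂ₜ g = -2 Ric(cov) + ℒ_W g`, `W = deTurckField g cov bg`. Since the Ricci tensor
(`IsLeviCivita.ricci_eq_ricci`), the DeTurck field (`deTurckField_eq_of_isLeviCivita`) and the
covariant derivative of the (differentiable) DeTurck field (`IsLeviCivita.eq_leviCivita_holds`)
do not depend on the witness, `rdt_rhs_eq_coord` gives, on `U : Opens E`:
`-2 Ric(cov)(X₀, Y₀) + ℒ_W g (X₀, Y₀) = ∑ᵢⱼ gʲⁱ D²G(x)(bᵢ, bⱼ)(X₀, Y₀) + rdtLower …`.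
[cite: AndrewsHopper2011, §5.4.1, (5.6)–(5.9)] [cite: AndrewsHopper2011, §5.4.2, (5.10)] -/
theorem rdt_rhs_eq_coord_of_isLeviCivita [g.HasLeviCivita]
    {cov : CovariantDerivative 𝓘(ℝ, E) E (TangentSpace 𝓘(ℝ, E) : U → Type _)}
    (hcov : g.IsLeviCivita cov) (x : U)
    (hCd : ∀ i j, DifferentiableAt ℝ (fun y : E ↦ Cb y (b i) (b j)) x) (X₀ Y₀ : E) :
    -2 * cov.ricci x X₀ Y₀ + lieDerivMetric g cov (deTurckField g cov bg) x X₀ Y₀ =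
      (∑ i, ∑ j, gramInv b (G x) j i * fderiv ℝ (fderiv ℝ G) x (b i) (b j) X₀ Y₀)
        + rdtLower b (G x) (gramInv b (G x)) (fderiv ℝ G x) (Cb x)
            (fun V Y₁ X₁ ↦ fderiv ℝ (fun y ↦ Cb y Y₁ X₁) x V) X₀ Y₀ := by
  have h2 : (2 : ℕ∞ω) ≤ ∞ := WithTop.coe_le_coe.mpr le_top
  have hW : deTurckField g cov bg = deTurckField g g.leviCivita bg :=
    deTurckField_eq_of_isLeviCivita hcov g.isLeviCivita_leviCivita_holds
  have hric : cov.ricci x = g.ricci x := hcov.ricci_eq_ricci h2 x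
  have hWd := mdifferentiableAt_deTurckField hG b bg hCb x hCd
  have hcovW : cov (deTurckField g g.leviCivita bg) x =
      g.leviCivita (deTurckField g g.leviCivita bg) x :=
    IsLeviCivita.eq_leviCivita_holds (g := g) hcov hWd
  rw [← rdt_rhs_eq_coord hG b bg hCb x hCd X₀ Y₀, hric, lieDerivMetric, lieDerivMetric, hW, hcovW]

end Ident

end OpensChart

end Literature.Geometry.Riemannian

end
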